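import Summits.AtomisticToContinuum.Crystallization.Theses.ChessboardParticlePlanes

/-!
# Crux `ChessboardParticlePlanes.LjPlaneChessboard` (stmt-AtomisticToContinuum-6709), line `Sketch`,
# stub `kernelForm_eq_entrySum` — the kernel form is a finset matrix lattice form of the entries

The per-site chessboard deficit summed over one vertical period is the KERNEL FORM
`Σ_{i₀ < n} Σ_{x ∈ F i₀} Σ_{m < n} Σ_{f' ∈ F m} Σ'_{v ∈ L} Σ'_j [A - B - C - D]`, the four terms
being evaluated at the planar arguments `πx - πf' - j πg₀ - v` (resp. `πx - πf' - v`), where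
`π y = (y₀, y₁)` is the horizontal projection and `L ⊂ ℝ²` the planar lattice.  With the ENTRY
FUNCTIONS `f_{i₀ m}(ρ) = Σ'_j [A - B - C - D](ρ - j πg₀ resp. ρ)` this is the real part of the
finset matrix lattice form
`Σ_{i₀, m : Fin n} Σ_{X ∈ π(F i₀)} Σ_{Y ∈ π(F m)} Σ'_{v ∈ L} f_{i₀ m}(X - Y + v)` (cast to `ℂ`),
which is the format of the Poisson positivity `matrixLatticeFormNonneg_finset`.

Proof: pure bookkeeping — the complex casts are pushed outward (`Complex.ofReal_tsum`,
`Complex.ofReal_sum`, no summability needed) and dropped (`Complex.ofReal_re`); `Finset.range n`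
sums become `Fin n` sums (`Finset.sum_range`); the two middle finite sums are exchanged
(`Finset.sum_comm`); the sums over the images `π(F m)` are pulled back to `F m` by the injectivity
of `π` on each `F m` (`Finset.sum_image`); finally inside the lattice series `v ↦ -v`
(`Equiv.tsum_eq` for `Equiv.neg L`) turns `πx - πf' - j πg₀ - v` into `πx - πf' + v - j πg₀`.
[folklore]  No definition is introduced.
-/

noncomputable section

namespace Summit.AtomisticToContinuum.Crystallization.Theorems.ChessboardParticlePlanesLjPlaneChessboard

open Literature.MathematicalPhysics.StatisticalMechanics

/-- The horizontal projection `f ↦ (f₀, f₁)` is injective on each finite layer set `F m` as soon as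
two points of `F m` with the same first two coordinates coincide. [folklore] -/
theorem kernelForm_proj_injOn {F : ℤ → Finset (EuclideanSpace ℝ (Fin 3))}
    (hF : ∀ m : ℤ, ∀ f ∈ F m, ∀ f' ∈ F m, (f 0 = f' 0 ∧ f 1 = f' 1) → f = f') (m : ℤ) :
    Set.InjOn (fun f : EuclideanSpace ℝ (Fin 3) => (!₂[f 0, f 1] : EuclideanSpace ℝ (Fin 2)))
      ↑(F m) := by
  intro f hf f' hf' h
  have h0 := congrArg (fun w : EuclideanSpace ℝ (Fin 2) => w 0) h
  have h1 := congrArg (fun w : EuclideanSpace ℝ (Fin 2) => w 1) h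
  simp only [Matrix.cons_val_zero, Matrix.cons_val_one, Matrix.cons_val_fin_one] at h0 h1
  exact hF m f hf f' hf' ⟨h0, h1⟩

/-- **The kernel form as a finset matrix lattice form of the entry functions** (stub
`kernelForm_eq_entrySum` of line `Sketch`): for `0 < n`, height gaps `≥ 3/4`, a vertical period
and the horizontal projection `π` injective on each `F m`,
`Σ_{i₀ < n} Σ_{x ∈ F i₀} Σ_{m < n} Σ_{f' ∈ F m} Σ'_{v ∈ L} Σ'_j [A - B - C - D](πx - πf' - j πg₀ - v)`
equals the real part of
`Σ_{i₀, m : Fin n} Σ_{X ∈ π(F i₀)} Σ_{Y ∈ π(F m)} Σ'_{v ∈ L} (f_{i₀ m}(X - Y + v) : ℂ)` with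
`f_{i₀ m}(ρ) = Σ'_j [A - B - C - D](ρ - j πg₀)`: `Finset.sum_range`, `Finset.sum_comm`,
`Finset.sum_image`, `v ↦ -v` in the lattice series, `Complex.ofReal_tsum`. [folklore] -/
theorem kernelForm_eq_entrySum :
    ∀ (z : ℤ → ℝ) (n : ℕ) (g₀ : EuclideanSpace ℝ (Fin 3)) (F : ℤ → Finset (EuclideanSpace ℝ (Fin 3)))
      (L : Submodule ℤ (EuclideanSpace ℝ (Fin 2))) [DiscreteTopology L] [IsZLattice ℝ L],
      0 < n → (∀ i : ℤ, (3 : ℝ) / 4 ≤ z (i + 1) - z i) → (∃ c₀ : ℝ, 0 < c₀ ∧ ∀ i : ℤ, z (i + n) = z i + c₀) →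
      (∀ m : ℤ, ∀ f ∈ F m, ∀ f' ∈ F m, (f 0 = f' 0 ∧ f 1 = f' 1) → f = f') →
      ∑ i₀ ∈ Finset.range n, ∑ x ∈ F i₀,
        ∑ m ∈ Finset.range n, ∑ f' ∈ F m, ∑' v : L,
        ∑' j : ℤ,
          ((if (m : ℤ) + j * n = (i₀ : ℤ) then 0 else
              2 * lennardJones (Real.sqrt
                (‖!₂[x 0, x 1] - !₂[f' 0, f' 1] - (j : ℝ) • !₂[g₀ 0, g₀ 1]
                    - (v : EuclideanSpace ℝ (Fin 2))‖ ^ 2 + (z (i₀ : ℤ) - z ((m : ℤ) + j * n)) ^ 2)))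
            - (if (m : ℤ) + j * n = (i₀ : ℤ) then
                ∑' k : {k : ℤ // k ≠ 0},
                  (lennardJones (Real.sqrt
                      (‖!₂[x 0, x 1] - !₂[f' 0, f' 1] - (v : EuclideanSpace ℝ (Fin 2))‖ ^ 2
                        + (2 * |(k : ℝ)| * (z ((i₀ : ℤ) + 1) - z (i₀ : ℤ))) ^ 2)) +
                   lennardJones (Real.sqrt
                      (‖!₂[x 0, x 1] - !₂[f' 0, f' 1] - (v : EuclideanSpace ℝ (Fin 2))‖ ^ 2
                        + (2 * |(k : ℝ)| * (z (i₀ : ℤ) - z ((i₀ : ℤ) - 1))) ^ 2)))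
               else 0)
            - (if (m : ℤ) + j * n = (i₀ : ℤ) + 1 then
                ∑' k : ℤ, lennardJones (Real.sqrt
                  (‖!₂[x 0, x 1] - !₂[f' 0, f' 1] - (j : ℝ) • !₂[g₀ 0, g₀ 1]
                      - (v : EuclideanSpace ℝ (Fin 2))‖ ^ 2
                    + (|2 * (k : ℝ) + 1| * (z ((i₀ : ℤ) + 1) - z (i₀ : ℤ))) ^ 2))
               else 0)
            - (if (m : ℤ) + j * n = (i₀ : ℤ) - 1 then
                ∑' k : ℤ, lennardJones (Real.sqrt
                  (‖!₂[x 0, x 1] - !₂[f' 0, f' 1] - (j : ℝ) • !₂[g₀ 0, g₀ 1]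
                      - (v : EuclideanSpace ℝ (Fin 2))‖ ^ 2
                    + (|2 * (k : ℝ) + 1| * (z (i₀ : ℤ) - z ((i₀ : ℤ) - 1))) ^ 2))
               else 0)) =
      (∑ i₀ : Fin n, ∑ m : Fin n, ∑ X ∈ (F i₀).image (fun f => !₂[f 0, f 1]),
        ∑ Y ∈ (F m).image (fun f => !₂[f 0, f 1]), ∑' v : L,
          (((∑' j : ℤ,
        ((if ((m : ℕ) : ℤ) + j * n = ((i₀ : ℕ) : ℤ) then 0 else
            2 * lennardJones (Real.sqrt (‖X - Y + (v : EuclideanSpace ℝ (Fin 2)) - (j : ℝ) • !₂[g₀ 0, g₀ 1]‖ ^ 2 + (z ((i₀ : ℕ) : ℤ) - z (((m : ℕ) : ℤ) + j * n)) ^ 2)))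
          - (if ((m : ℕ) : ℤ) + j * n = ((i₀ : ℕ) : ℤ) then
              ∑' k : {k : ℤ // k ≠ 0},
                (lennardJones (Real.sqrt (‖X - Y + (v : EuclideanSpace ℝ (Fin 2))‖ ^ 2 + (2 * |(k : ℝ)| * (z (((i₀ : ℕ) : ℤ) + 1) - z ((i₀ : ℕ) : ℤ))) ^ 2)) +
                 lennardJones (Real.sqrt (‖X - Y + (v : EuclideanSpace ℝ (Fin 2))‖ ^ 2 + (2 * |(k : ℝ)| * (z ((i₀ : ℕ) : ℤ) - z (((i₀ : ℕ) : ℤ) - 1))) ^ 2)))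
             else 0)
          - (if ((m : ℕ) : ℤ) + j * n = ((i₀ : ℕ) : ℤ) + 1 then
              ∑' k : ℤ, lennardJones (Real.sqrt (‖X - Y + (v : EuclideanSpace ℝ (Fin 2)) - (j : ℝ) • !₂[g₀ 0, g₀ 1]‖ ^ 2
                + (|2 * (k : ℝ) + 1| * (z (((i₀ : ℕ) : ℤ) + 1) - z ((i₀ : ℕ) : ℤ))) ^ 2))
             else 0)
          - (if ((m : ℕ) : ℤ) + j * n = ((i₀ : ℕ) : ℤ) - 1 then
              ∑' k : ℤ, lennardJones (Real.sqrt (‖X - Y + (v : EuclideanSpace ℝ (Fin 2)) - (j : ℝ) • !₂[g₀ 0, g₀ 1]‖ ^ 2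
                + (|2 * (k : ℝ) + 1| * (z ((i₀ : ℕ) : ℤ) - z (((i₀ : ℕ) : ℤ) - 1))) ^ 2))
             else 0)) : ℝ) : ℂ))).re := by
  intro z n g₀ F L _ _ _hn _hgap _hper hF
  -- (v) push the complex casts outward and drop them
  simp only [← Complex.ofReal_tsum, ← Complex.ofReal_sum, Complex.ofReal_re]
  -- (i) `Finset.range n` sums as `Fin n` sums
  simp only [Finset.sum_range]
  refine Finset.sum_congr rfl fun i₀ _ => ?_
  -- (ii) exchange the two middle finite sums
  rw [Finset.sum_comm]
  refine Finset.sum_congr rfl fun m _ => ?_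
  -- (iii) the sums over the projected layers
  rw [Finset.sum_image (kernelForm_proj_injOn hF _)]
  refine Finset.sum_congr rfl fun x _ => ?_
  rw [Finset.sum_image (kernelForm_proj_injOn hF _)]
  refine Finset.sum_congr rfl fun f' _ => ?_
  -- (iv) `v ↦ -v` in the lattice series
  rw [← (Equiv.neg L).tsum_eq]
  simp only [Equiv.neg_apply, Submodule.coe_neg, sub_neg_eq_add,
    sub_add_eq_add_sub (!₂[x 0, x 1] - !₂[f' 0, f' 1] : EuclideanSpace ℝ (Fin 2))]

end Summit.AtomisticToContinuum.Crystallization.Theorems.ChessboardParticlePlanesLjPlaneChessboard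

end
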